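import Mathlib
import Literature.NumberTheory.LFunctions.Zhang2022.ToolkitRoughEulerMajorant
import Literature.NumberTheory.LFunctions.Zhang2022.ToolkitSmallPrimeFactorSums
import Literature.NumberTheory.LFunctions.Zhang2022.Section17U021ChiR1Prelims
import Literature.NumberTheory.Sieve.AsymptoticSieveForPrimesReduction
import HarnessLib

/-!
# Toolkit: Euler-product sums CARRYING THE `κ₂`-GAIN — `Σ_{m≥2} G(m)|κ₂(m)|/m ≤ e^X − 1`,
# `Σ_{ω(m)≥2} ≤ X²`, with the prime sum `X` left free — and the `m₁`-extraction
# `Σ_{m₁} τ₂(m₁)|κ₂(m₁m₂)|/m₁ ≤ |κ₂(m₂)|·∏_{p∣m₂}(1+6/p)·e^{6|b₁|(log N+log 4)}`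

Topic `Literature/NumberTheory/LFunctions/Zhang2022` (Landau–Siegel audit tree; verdict-neutral; ZHANG-L
discharge lane, WP16 helper toolkit for the §17.u021-χ remainder `R₁`, seat zl-w16-p4; companion of
`ToolkitSmoothEulerMajorant` / `ToolkitRoughEulerMajorant` / `ToolkitSmallPrimeFactorSums`). In Y. Zhang,
*Discrete mean estimates and the Landau–Siegel zero*, arXiv:2211.02515v1 (2022) [Zhang2022LandauSiegel] —
an unrefereed manuscript under adjudication; nothing here bears on its Theorems 1–2 — §17 p. 98 (u021)
drops "the terms with `m₂ > 1` … with an acceptable error". Every such term carries the coefficient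
`κ̄₂(m₁m₂)` with `m₂ ≥ 2`, and `|κ₂(q^r)| = |q^{−ib₁} − 1| ≤ |b₁| log q` (App. A p. 105) at EVERY prime
power: the gain must be summed multiplicatively with ALL its local factors kept (a single factor
`|b₁|log M` against a crude divisor count loses `(log M)^k`). This file proves the arithmetic engines
(theorems only; no definitions; standard axioms), for arbitrary local shape weights `g(q,r) ≥ 0`,
`g(q,r) ≤ (r+1)^d`, on a finite set `A` of `s`-factored numbers, `M_g(n) := ∏_{q^r∥n} g(q,r)`:

* `sum_factored_multMajorant_div_sub_one_le` — `Σ_{n∈A, n≠1} M_a(n)/n ≤ ∏_{q∈s}(1 + Σ_{r≥1}a(q,r)/q^r) − 1`;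
* `sum_factored_multMajorant_div_le_of_two_le_card` — `Σ_{n∈A, ω(n)≥2} M_a(n)/n ≤ ∏_q(1+x_q) − 1 − Σ_q x_q`,
  `x_q = Σ_{r≥1}a(q,r)/q^r` (the terms `n = 1` and `n = q^r` of the Euler product are exactly `1 + Σ_q x_q`);
* `prod_one_add_sub_one_le`, `prod_one_add_sub_one_sub_sum_le` — for `x_q ≥ 0`, `Σx_q ≤ 1`:
  `∏(1+x_q) − 1 ≤ 2Σx_q`, `∏(1+x_q) − 1 − Σx_q ≤ (Σx_q)²` (`∏(1+x_q) ≤ e^{Σx_q}` is the tree's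
  `Literature.NumberTheory.Sieve.prod_one_add_le_exp_sum`);
* `tsum_shape_div_pow_succ_le` — `Σ_{r≥1} g(q,r)/q^r ≤ g(q,1)/q + S_d/q²` (`S_d = LogEulerProduct.tailConst d`);
* `sum_multMajorant_mul_norm_kappa₂_div_le` — **`Σ_{n∈A, n≠1} M_g(n)|κ₂(n)|/n ≤ e^{X} − 1`**,
  `X = Σ_{q∈s}|q^{−ib}−1|(g(q,1)/q + S_d/q²)`, and `… ≤ 2X`, and the `ω(n) ≥ 2` part `≤ X²` (for `X ≤ 1`);
  `sum_norm_powI_sub_one_mul_le` — `X ≤ |b|·Σ_{q∈s} log q·(g(q,1)/q + S_d/q²)`;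
* `sum_tau_mul_norm_kappa₂_mul_div_le` — the `m₁`-EXTRACTION: for `m₂ ≥ 1`,
  `Σ_{1≤m₁≤N} τ₂(m₁)|κ₂(m₁m₂)|/m₁ ≤ |κ₂(m₂)|·∏_{p∣m₂}(1 + 6/p)·exp(6|b|(log N + log 4))`
  (`|κ₂(m₁m₂)| = |κ₂(m₂)|·∏_{q∣m₁, q∤m₂}|q^{−ib}−1|`, `Typed.Section17.norm_kappa₂_mul_eq`; the whole gain is
  allotted to `m₂`, so no "Case A / Case B" split over the primes shared by `m₁` and `m₂` is needed).

## References

* R. R. Hall, G. Tenenbaum, *Divisors*, Cambridge Tracts in Math. 90 (1988), §0.2, (0.4).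
  [cite: HallTenenbaum1988, §0.2]
* Y. Zhang, arXiv:2211.02515v1 (2022), §17 p. 98 (u021); App. A p. 105 (`κ₂(q^r)`).
  [cite: Zhang2022LandauSiegel, §17 u021 p.98]
-/

noncomputable section

open Real Finset Filter Topology
open Literature.NumberTheory.LFunctions.Zhang2022.MeanSquareMajorant (kappa₂ powI isMultiplicative_kappa₂
  tau isMultiplicative_tau tau_two_prime_pow norm_powI_sub_one_le)
open Literature.NumberTheory.LFunctions.Zhang2022.Typed.Section17 (norm_kappa₂_eq_prod_primeFactors
  norm_kappa₂_mul_eq)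

namespace Literature.NumberTheory.LFunctions.Zhang2022.SmoothEulerMajorant

/-! ## §1 Local helpers -/

/-- `M_a(q^r) = a(q,r)` at a prime power, `r ≥ 1`. [folklore] -/
private theorem majorant_prime_pow (a : ℕ → ℕ → ℝ) {q : ℕ} (hq : q.Prime) {r : ℕ} (hr : r ≠ 0) :
    ∏ p ∈ (q ^ r).primeFactors, a p ((q ^ r).factorization p) = a q r := by
  rw [Nat.primeFactors_prime_pow hr hq, Finset.prod_singleton, Nat.Prime.factorization_pow hq,
    Finsupp.single_eq_same]

/-- `M_a(1) / 1 = 1`. [folklore] -/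
private theorem majorant_one_div (a : ℕ → ℕ → ℝ) :
    (∏ p ∈ (1 : ℕ).primeFactors, a p ((1 : ℕ).factorization p)) / ((1 : ℕ) : ℝ) = 1 := by
  simp

/-- `1` is `s`-factored. [folklore] -/
private theorem one_mem_factoredNumbers (s : Finset ℕ) : 1 ∈ Nat.factoredNumbers s :=
  Nat.mem_factoredNumbers_iff_primeFactors_subset.mpr ⟨one_ne_zero, by simp⟩

/-- A prime power `q^(r+1)` with `q ∈ s` is `s`-factored. [folklore] -/
private theorem prime_pow_mem_factoredNumbers {s : Finset ℕ} {q : ℕ} (hq : q.Prime) (hqs : q ∈ s)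
    (r : ℕ) : q ^ (r + 1) ∈ Nat.factoredNumbers s :=
  Nat.mem_factoredNumbers_iff_primeFactors_subset.mpr
    ⟨pow_ne_zero _ hq.ne_zero, by
      rw [Nat.primeFactors_prime_pow (Nat.succ_ne_zero r) hq]
      exact Finset.singleton_subset_iff.mpr hqs⟩

/-- `Σ_{j≥0} (j+2)·2^{−j} = 6`. [folklore] -/
private theorem hasSum_succ_two_mul_half_pow :
    HasSum (fun j : ℕ => ((j : ℝ) + 2) * (1 / 2 : ℝ) ^ j) 6 := by
  have h1 : HasSum (fun j : ℕ => (j : ℝ) * (1 / 2 : ℝ) ^ j) ((1 / 2 : ℝ) / (1 - 1 / 2) ^ 2) :=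
    hasSum_coe_mul_geometric_of_norm_lt_one (by norm_num)
  have h2 : HasSum (fun j : ℕ => (2 : ℝ) * (1 / 2 : ℝ) ^ j) (2 * 2) := hasSum_geometric_two.mul_left 2
  convert h1.add h2 using 1
  · funext j; ring
  · norm_num

/-- `Σ_{r≥0} (r+2)/q^{r+1} ≤ 6/q` for `q ≥ 2` (the local sum `Σ_{k≥1}(k+1)q^{−k}` of `τ₂` at a prime,
Hall–Tenenbaum (0.4)). [cite: HallTenenbaum1988, (0.4)] -/
theorem tsum_succ_two_div_pow_succ_le {q : ℕ} (hq : 2 ≤ q) :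
    Summable (fun r : ℕ => ((r : ℝ) + 2) / (q : ℝ) ^ (r + 1)) ∧
      ∑' r : ℕ, ((r : ℝ) + 2) / (q : ℝ) ^ (r + 1) ≤ 6 / q := by
  have hq0 : (0 : ℝ) < q := by exact_mod_cast (by omega : 0 < q)
  have hq2 : (2 : ℝ) ≤ q := by exact_mod_cast hq
  have hterm : ∀ r : ℕ, ((r : ℝ) + 2) / (q : ℝ) ^ (r + 1) ≤
      (1 / q) * (((r : ℝ) + 2) * (1 / 2 : ℝ) ^ r) := by
    intro r
    rw [pow_succ, div_le_iff₀ (by positivity)]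
    have hx : (1 / q : ℝ) ^ r ≤ (1 / 2 : ℝ) ^ r :=
      pow_le_pow_left₀ (by positivity) (one_div_le_one_div_of_le (by norm_num) hq2) r
    have h1 : (1 / q : ℝ) ^ r * (q : ℝ) ^ r = 1 := by
      rw [← mul_pow, one_div_mul_cancel hq0.ne', one_pow]
    have h2 : (1 / q : ℝ) * (q : ℝ) = 1 := one_div_mul_cancel hq0.ne'
    calc ((r : ℝ) + 2) = ((r : ℝ) + 2) * ((1 / q : ℝ) ^ r * (q : ℝ) ^ r) * ((1 / q : ℝ) * q) := by
          rw [h1, h2]; ring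
      _ ≤ ((r : ℝ) + 2) * ((1 / 2 : ℝ) ^ r * (q : ℝ) ^ r) * ((1 / q : ℝ) * q) := by gcongr
      _ = 1 / q * (((r : ℝ) + 2) * (1 / 2 : ℝ) ^ r) * ((q : ℝ) ^ r * q) := by ring
  have hnn : ∀ r : ℕ, 0 ≤ ((r : ℝ) + 2) / (q : ℝ) ^ (r + 1) := fun r => by positivity
  have hmaj : Summable fun r : ℕ => (1 / q : ℝ) * (((r : ℝ) + 2) * (1 / 2 : ℝ) ^ r) :=
    hasSum_succ_two_mul_half_pow.summable.mul_left _
  have hs : Summable fun r : ℕ => ((r : ℝ) + 2) / (q : ℝ) ^ (r + 1) :=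
    Summable.of_nonneg_of_le hnn hterm hmaj
  refine ⟨hs, ?_⟩
  calc ∑' r : ℕ, ((r : ℝ) + 2) / (q : ℝ) ^ (r + 1)
      ≤ ∑' r : ℕ, (1 / q : ℝ) * (((r : ℝ) + 2) * (1 / 2 : ℝ) ^ r) := hs.tsum_le_tsum hterm hmaj
    _ = (1 / q) * 6 := by rw [tsum_mul_left, hasSum_succ_two_mul_half_pow.tsum_eq]
    _ = 6 / q := by ring

/-- `∏_{s} f ≤ ∏_{t} f` for `s ⊆ t` when `f ≥ 0` on `t` and `f ≥ 1` on `t ∖ s` (real-valued).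
[folklore] -/
private theorem prod_le_prod_of_subset_real {ι : Type*} [DecidableEq ι] {s t : Finset ι}
    (h : s ⊆ t) {f : ι → ℝ} (hf0 : ∀ i ∈ t, 0 ≤ f i) (hf1 : ∀ i ∈ t, i ∉ s → 1 ≤ f i) :
    ∏ i ∈ s, f i ≤ ∏ i ∈ t, f i := by
  rw [← Finset.prod_sdiff h]
  have h1 : (1 : ℝ) ≤ ∏ i ∈ t \ s, f i :=
    calc (1 : ℝ) = ∏ _i ∈ t \ s, (1 : ℝ) := Finset.prod_const_one.symm
      _ ≤ ∏ i ∈ t \ s, f i := Finset.prod_le_prod (fun _ _ => zero_le_one) fun i hi =>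
          hf1 i (Finset.mem_sdiff.mp hi).1 (Finset.mem_sdiff.mp hi).2
  exact le_mul_of_one_le_left (Finset.prod_nonneg fun i hi => hf0 i (h hi)) h1

/-! ## §2 The Euler product minus its trivial term, and minus its prime-power terms -/

/-- **Euler-product majorant without the term `n = 1`.** For local weights `a(q,r) ≥ 0` with
`Σ_{r≥1}a(q,r)q^{−r}` convergent at every prime and a finite set `A` of `s`-factored numbers,
`Σ_{n∈A, n≠1} M_a(n)/n ≤ ∏_{q∈s prime}(1 + Σ_{r≥1}a(q,r)/q^r) − 1` (`M_a(n) = ∏_{q^r∥n}a(q,r)`;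
the term `n = 1` of the full Euler-product bound `sum_factored_multMajorant_div_le_prod` is `1`).
[cite: HallTenenbaum1988, §0.2] -/
theorem sum_factored_multMajorant_div_sub_one_le {a : ℕ → ℕ → ℝ} (ha : ∀ q r, 0 ≤ a q r)
    (hsum : ∀ q : ℕ, q.Prime → Summable fun r : ℕ => a q (r + 1) / (q : ℝ) ^ (r + 1))
    {s : Finset ℕ} {A : Finset ℕ} (hA : ∀ n ∈ A, n ∈ Nat.factoredNumbers s) :
    ∑ n ∈ A with n ≠ 1, (∏ q ∈ n.primeFactors, a q (n.factorization q)) / n ≤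
      ∏ q ∈ s with q.Prime, (1 + ∑' r : ℕ, a q (r + 1) / (q : ℝ) ^ (r + 1)) - 1 := by
  classical
  have h1 : (1 : ℕ) ∉ A.filter (fun n => n ≠ 1) := by simp
  have hA' : ∀ n ∈ insert 1 (A.filter (fun n => n ≠ 1)), n ∈ Nat.factoredNumbers s := by
    intro n hn
    rcases Finset.mem_insert.mp hn with rfl | hn
    · exact one_mem_factoredNumbers s
    · exact hA n (Finset.mem_filter.mp hn).1
  have h := sum_factored_multMajorant_div_le_prod ha hsum hA'
  rw [Finset.sum_insert h1, majorant_one_div] at h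
  linarith

/-- **Euler-product majorant without the terms `n = 1` and `n = q^r`**: with `x_q = Σ_{r≥1}a(q,r)/q^r`,
`Σ_{n∈A, ω(n)≥2} M_a(n)/n ≤ ∏_{q∈s prime}(1 + x_q) − 1 − Σ_{q∈s prime} x_q` — the numbers with at most
one prime factor contribute exactly `1 + Σ_q x_q` to the Euler product, and every term is `≥ 0`
(proved through the truncations `r ≤ R` and `R → ∞`). [cite: HallTenenbaum1988, §0.2] -/
theorem sum_factored_multMajorant_div_le_of_two_le_card {a : ℕ → ℕ → ℝ} (ha : ∀ q r, 0 ≤ a q r)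
    (hsum : ∀ q : ℕ, q.Prime → Summable fun r : ℕ => a q (r + 1) / (q : ℝ) ^ (r + 1))
    {s : Finset ℕ} {A : Finset ℕ} (hA : ∀ n ∈ A, n ∈ Nat.factoredNumbers s) :
    ∑ n ∈ A with 2 ≤ n.primeFactors.card, (∏ q ∈ n.primeFactors, a q (n.factorization q)) / n ≤
      ∏ q ∈ s with q.Prime, (1 + ∑' r : ℕ, a q (r + 1) / (q : ℝ) ^ (r + 1)) - 1 -
        ∑ q ∈ s with q.Prime, ∑' r : ℕ, a q (r + 1) / (q : ℝ) ^ (r + 1) := by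
  classical
  set f : ℕ → ℝ := fun n => (∏ q ∈ n.primeFactors, a q (n.factorization q)) / n with hf
  set P : Finset ℕ := s.filter Nat.Prime with hP
  set A₂ : Finset ℕ := A.filter (fun n => 2 ≤ n.primeFactors.card) with hA₂
  have hPprime : ∀ q ∈ P, q.Prime := fun q hq => (Finset.mem_filter.mp hq).2
  have hfpow : ∀ {q : ℕ}, q.Prime → ∀ r : ℕ, f (q ^ (r + 1)) = a q (r + 1) / (q : ℝ) ^ (r + 1) := by
    intro q hq r
    simp only [hf]
    rw [majorant_prime_pow a hq (Nat.succ_ne_zero r), Nat.cast_pow]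
  -- the truncated bound, for every `R`
  have hR : ∀ R : ℕ, ∑ n ∈ A₂, f n + ∑ q ∈ P, ∑ r ∈ Finset.range R, a q (r + 1) / (q : ℝ) ^ (r + 1) ≤
      ∏ q ∈ P, (1 + ∑' r : ℕ, a q (r + 1) / (q : ℝ) ^ (r + 1)) - 1 := by
    intro R
    set PP : Finset ℕ := P.biUnion (fun q => (Finset.range R).image (fun r => q ^ (r + 1))) with hPP
    have hmemPP : ∀ {n : ℕ}, n ∈ PP → ∃ q ∈ P, ∃ r < R, n = q ^ (r + 1) := by
      intro n hn
      obtain ⟨q, hq, hn⟩ := Finset.mem_biUnion.mp hn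
      obtain ⟨r, hr, rfl⟩ := Finset.mem_image.mp hn
      exact ⟨q, hq, r, Finset.mem_range.mp hr, rfl⟩
    have hdisj : Disjoint A₂ PP := by
      rw [Finset.disjoint_left]
      intro n hnA hnP
      obtain ⟨q, hq, r, -, rfl⟩ := hmemPP hnP
      have h2 := (Finset.mem_filter.mp hnA).2
      rw [Nat.primeFactors_prime_pow (Nat.succ_ne_zero r) (hPprime q hq), Finset.card_singleton] at h2
      omega
    have h1 : (1 : ℕ) ∉ A₂ ∪ PP := by
      intro h
      rcases Finset.mem_union.mp h with h | h
      · have h2 := (Finset.mem_filter.mp h).2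
        simp at h2
      · obtain ⟨q, hq, r, -, h1⟩ := hmemPP h
        have : 2 ≤ q ^ (r + 1) :=
          le_trans (hPprime q hq).two_le (Nat.le_self_pow (Nat.succ_ne_zero r) q)
        omega
    have hU : ∀ n ∈ insert 1 (A₂ ∪ PP), n ∈ Nat.factoredNumbers s := by
      intro n hn
      rcases Finset.mem_insert.mp hn with rfl | hn
      · exact one_mem_factoredNumbers s
      rcases Finset.mem_union.mp hn with hn | hn
      · exact hA n (Finset.mem_filter.mp hn).1
      · obtain ⟨q, hq, r, -, rfl⟩ := hmemPP hn
        exact prime_pow_mem_factoredNumbers (hPprime q hq) (Finset.mem_filter.mp hq).1 r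
    have h := sum_factored_multMajorant_div_le_prod ha hsum hU
    rw [Finset.sum_insert h1, majorant_one_div, Finset.sum_union hdisj] at h
    -- the prime-power part is the truncated double sum
    have hPPsum : ∑ n ∈ PP, f n = ∑ q ∈ P, ∑ r ∈ Finset.range R, a q (r + 1) / (q : ℝ) ^ (r + 1) := by
      rw [hPP, Finset.sum_biUnion]
      · refine Finset.sum_congr rfl fun q hq => ?_
        have hqp := hPprime q hq
        rw [Finset.sum_image]
        · exact Finset.sum_congr rfl fun r _ => hfpow hqp r
        · intro r _ r' _ hrr
          have := Nat.pow_right_injective hqp.two_le hrr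
          omega
      · intro q hq q' hq' hne
        simp only [Function.onFun]
        rw [Finset.disjoint_left]
        intro n hn hn'
        obtain ⟨r, -, rfl⟩ := Finset.mem_image.mp hn
        obtain ⟨r', -, h'⟩ := Finset.mem_image.mp hn'
        have hqp := hPprime q (Finset.mem_coe.mp hq)
        have hqp' := hPprime q' (Finset.mem_coe.mp hq')
        have hdvd : q' ∣ q ^ (r + 1) := by rw [← h']; exact dvd_pow_self q' (Nat.succ_ne_zero r')
        exact hne ((Nat.prime_dvd_prime_iff_eq hqp' hqp).mp (hqp'.dvd_of_dvd_pow hdvd)).symm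
    have hfA : ∑ n ∈ A₂, f n = ∑ n ∈ A₂, (∏ q ∈ n.primeFactors, a q (n.factorization q)) / n := rfl
    rw [hPPsum] at h
    linarith
  -- `R → ∞`
  have hlim : Tendsto (fun R : ℕ => ∑ n ∈ A₂, f n +
      ∑ q ∈ P, ∑ r ∈ Finset.range R, a q (r + 1) / (q : ℝ) ^ (r + 1)) atTop
      (𝓝 (∑ n ∈ A₂, f n + ∑ q ∈ P, ∑' r : ℕ, a q (r + 1) / (q : ℝ) ^ (r + 1))) := by
    refine tendsto_const_nhds.add (tendsto_finsetSum _ fun q hq => ?_)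
    exact (hsum q (hPprime q hq)).hasSum.tendsto_sum_nat
  have hle := le_of_tendsto' hlim hR
  have hfA : ∑ n ∈ A₂, f n = ∑ n ∈ A₂, (∏ q ∈ n.primeFactors, a q (n.factorization q)) / n := rfl
  linarith

/-! ## §3 `∏(1 + x_q)` against `exp(Σ x_q)` -/

/-- `∏_{q}(1 + x_q) − 1 ≤ 2·Σ_q x_q` for `x_q ≥ 0` with `Σ_q x_q ≤ 1` (`eˣ − 1 ≤ 2x` on `[0,1]`;
Euler product vs. prime sum as in Hall–Tenenbaum (0.4)). [cite: HallTenenbaum1988, (0.4)] -/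
theorem prod_one_add_sub_one_le {ι : Type*} (s : Finset ι) {x : ι → ℝ} (hx : ∀ i ∈ s, 0 ≤ x i)
    (hX : ∑ i ∈ s, x i ≤ 1) : ∏ i ∈ s, (1 + x i) - 1 ≤ 2 * ∑ i ∈ s, x i := by
  have h0 : 0 ≤ ∑ i ∈ s, x i := Finset.sum_nonneg hx
  have h1 := Literature.NumberTheory.Sieve.prod_one_add_le_exp_sum s hx
  have h2 := Real.abs_exp_sub_one_le (x := ∑ i ∈ s, x i) (by rwa [abs_of_nonneg h0])
  rw [abs_of_nonneg h0] at h2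
  linarith [(abs_le.mp h2).2]

/-- `∏_{q}(1 + x_q) − 1 − Σ_q x_q ≤ (Σ_q x_q)²` for `x_q ≥ 0` with `Σ_q x_q ≤ 1`
(`eˣ − 1 − x ≤ x²` on `[0,1]`; Euler product vs. prime sum as in Hall–Tenenbaum (0.4)).
[cite: HallTenenbaum1988, (0.4)] -/
theorem prod_one_add_sub_one_sub_sum_le {ι : Type*} (s : Finset ι) {x : ι → ℝ}
    (hx : ∀ i ∈ s, 0 ≤ x i) (hX : ∑ i ∈ s, x i ≤ 1) :
    ∏ i ∈ s, (1 + x i) - 1 - ∑ i ∈ s, x i ≤ (∑ i ∈ s, x i) ^ 2 := by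
  have h0 : 0 ≤ ∑ i ∈ s, x i := Finset.sum_nonneg hx
  have h1 := Literature.NumberTheory.Sieve.prod_one_add_le_exp_sum s hx
  have h2 := Real.abs_exp_sub_one_sub_id_le (x := ∑ i ∈ s, x i) (by rwa [abs_of_nonneg h0])
  linarith [(abs_le.mp h2).2]

/-! ## §4 Local sums of a shape weight `g(q,r) ≤ (r+1)^d` -/

/-- **The local sum of a divisor-type shape.** For a prime `q` and `0 ≤ g(q,r) ≤ (r+1)^d`:
`Σ_{r≥1} g(q,r)/q^r` converges and is `≤ g(q,1)/q + S_d/q²`, `S_d = Σ_{i≥0}(i+3)^d 2^{−i}`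
(`LogEulerProduct.tailConst d`) — the terms `r = i + 2` are `≤ (i+3)^d 2^{−i}/q²`.
[cite: HallTenenbaum1988, (0.4)] -/
theorem tsum_shape_div_pow_succ_le {g : ℕ → ℕ → ℝ} {d q : ℕ} (hq : q.Prime)
    (hg0 : ∀ r, 0 ≤ g q r) (hg : ∀ r, g q r ≤ ((r : ℝ) + 1) ^ d) :
    Summable (fun r : ℕ => g q (r + 1) / (q : ℝ) ^ (r + 1)) ∧
      ∑' r : ℕ, g q (r + 1) / (q : ℝ) ^ (r + 1) ≤
        g q 1 / q + LogEulerProduct.tailConst d / (q : ℝ) ^ 2 := by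
  have hq2 : (2 : ℝ) ≤ q := by exact_mod_cast hq.two_le
  have hq0 : (0 : ℝ) < q := by linarith
  -- the tail terms `r = i + 2`
  have hterm2 : ∀ i : ℕ, g q (i + 2) / (q : ℝ) ^ (i + 2) ≤
      ((i : ℝ) + 3) ^ d * (1 / 2 : ℝ) ^ i / (q : ℝ) ^ 2 := by
    intro i
    rw [div_le_div_iff₀ (by positivity) (by positivity)]
    have h1 : g q (i + 2) ≤ ((i : ℝ) + 3) ^ d := by
      have h := hg (i + 2)
      have e : (((i + 2 : ℕ) : ℝ) + 1) = (i : ℝ) + 3 := by push_cast; ring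
      rwa [e] at h
    have h2 : (q : ℝ) ^ 2 ≤ (1 / 2 : ℝ) ^ i * (q : ℝ) ^ (i + 2) := by
      rw [pow_add, ← mul_assoc, ← mul_pow]
      exact le_mul_of_one_le_left (by positivity) (one_le_pow₀ (by linarith))
    calc g q (i + 2) * (q : ℝ) ^ 2 ≤ ((i : ℝ) + 3) ^ d * (q : ℝ) ^ 2 :=
        mul_le_mul_of_nonneg_right h1 (by positivity)
      _ ≤ ((i : ℝ) + 3) ^ d * ((1 / 2 : ℝ) ^ i * (q : ℝ) ^ (i + 2)) :=
        mul_le_mul_of_nonneg_left h2 (by positivity)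
      _ = ((i : ℝ) + 3) ^ d * (1 / 2 : ℝ) ^ i * (q : ℝ) ^ (i + 2) := by ring
  have hs2 : Summable (fun i : ℕ => ((i : ℝ) + 3) ^ d * (1 / 2 : ℝ) ^ i / (q : ℝ) ^ 2) :=
    (LogEulerProduct.summable_tailConst d).div_const _
  have hstail : Summable (fun i : ℕ => g q (i + 2) / (q : ℝ) ^ (i + 2)) :=
    Summable.of_nonneg_of_le (fun i => div_nonneg (hg0 _) (by positivity)) hterm2 hs2
  have hs : Summable (fun r : ℕ => g q (r + 1) / (q : ℝ) ^ (r + 1)) := by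
    have e : (fun i : ℕ => g q (i + 2) / (q : ℝ) ^ (i + 2)) =
        fun i : ℕ => (fun r : ℕ => g q (r + 1) / (q : ℝ) ^ (r + 1)) (i + 1) := by
      funext i; rfl
    rw [e] at hstail
    exact (summable_nat_add_iff 1).mp hstail
  refine ⟨hs, ?_⟩
  rw [hs.tsum_eq_zero_add]
  have htail : ∑' i : ℕ, g q (i + 1 + 1) / (q : ℝ) ^ (i + 1 + 1) ≤
      LogEulerProduct.tailConst d / (q : ℝ) ^ 2 := by
    have e : (fun i : ℕ => g q (i + 1 + 1) / (q : ℝ) ^ (i + 1 + 1)) =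
        fun i : ℕ => g q (i + 2) / (q : ℝ) ^ (i + 2) := by funext i; rfl
    rw [e]
    calc ∑' i : ℕ, g q (i + 2) / (q : ℝ) ^ (i + 2)
        ≤ ∑' i : ℕ, ((i : ℝ) + 3) ^ d * (1 / 2 : ℝ) ^ i / (q : ℝ) ^ 2 :=
          hstail.tsum_le_tsum hterm2 hs2
      _ = LogEulerProduct.tailConst d / (q : ℝ) ^ 2 := by rw [tsum_div_const]; rfl
  have e0 : g q (0 + 1) / (q : ℝ) ^ (0 + 1) = g q 1 / q := by simp
  rw [e0]
  linarith

/-! ## §5 The engines carrying the `κ₂`-gain -/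

/-- **`M_g(n)·|κ₂(n)|` is itself a prime-power majorant**: for `n ≥ 1`,
`M_g(n)·|κ₂(n)| = ∏_{q^r∥n} (g(q,r)·|q^{−ib} − 1|)` (`|κ₂(n)| = ∏_{q∣n}|q^{−ib}−1|`, App. A p. 105:
the norm of `κ₂` only sees the radical). [cite: Zhang2022LandauSiegel, App. A p. 105] -/
theorem multMajorant_mul_norm_kappa₂_eq (b : ℝ) (g : ℕ → ℕ → ℝ) {n : ℕ} (hn : n ≠ 0) :
    (∏ q ∈ n.primeFactors, g q (n.factorization q)) * ‖kappa₂ b n‖ =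
      ∏ q ∈ n.primeFactors, (g q (n.factorization q) * ‖powI b q - 1‖) := by
  rw [norm_kappa₂_eq_prod_primeFactors b hn, ← Finset.prod_mul_distrib]

/-- **Bounding the free prime sum**: `Σ_{q}|q^{−ib}−1|·c_q ≤ |b|·Σ_q (log q)·c_q` for `c_q ≥ 0` on primes
(`|q^{−ib} − 1| ≤ |b| log q`). [cite: Zhang2022LandauSiegel, App. A p. 105] -/
theorem sum_norm_powI_sub_one_mul_le (b : ℝ) {P : Finset ℕ} (hP : ∀ q ∈ P, q.Prime) {c : ℕ → ℝ}
    (hc : ∀ q ∈ P, 0 ≤ c q) :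
    ∑ q ∈ P, ‖powI b q - 1‖ * c q ≤ |b| * ∑ q ∈ P, Real.log q * c q := by
  rw [Finset.mul_sum]
  refine Finset.sum_le_sum fun q hq => ?_
  rw [← mul_assoc]
  exact mul_le_mul_of_nonneg_right (norm_powI_sub_one_le b (hP q hq).pos) (hc q hq)

/-- **THE `κ₂`-GAIN EULER SUM, exponential form.** For `0 ≤ g(q,r) ≤ (r+1)^d` and a finite set `A` of
`s`-factored numbers: `Σ_{n∈A, n≠1} M_g(n)|κ₂(n)|/n ≤ exp(X) − 1`,
`X = Σ_{q∈s prime}|q^{−ib}−1|·(g(q,1)/q + S_d/q²)` — every `n ≥ 2` pays the gain at each of its primes, and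
the prime sum `X` is left free (in §17: `q ≤ T²`, `|q^{−ib₁}−1| ≤ |b₁|log q`, `X ≍ α𝓛^{1.1} = π𝓛^{−7.9}`).
[cite: Zhang2022LandauSiegel, §17 u021 p.98] -/
theorem sum_multMajorant_mul_norm_kappa₂_div_le (b : ℝ) {g : ℕ → ℕ → ℝ} {d : ℕ}
    (hg0 : ∀ q r, 0 ≤ g q r) (hg : ∀ q r, q.Prime → g q r ≤ ((r : ℝ) + 1) ^ d)
    {s A : Finset ℕ} (hA : ∀ n ∈ A, n ∈ Nat.factoredNumbers s) :
    ∑ n ∈ A with n ≠ 1, (∏ q ∈ n.primeFactors, g q (n.factorization q)) * ‖kappa₂ b n‖ / n ≤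
      Real.exp (∑ q ∈ s with q.Prime,
        ‖powI b q - 1‖ * (g q 1 / q + LogEulerProduct.tailConst d / (q : ℝ) ^ 2)) - 1 := by
  classical
  set a : ℕ → ℕ → ℝ := fun q r => g q r * ‖powI b q - 1‖ with ha_def
  have ha : ∀ q r, 0 ≤ a q r := fun q r => mul_nonneg (hg0 q r) (norm_nonneg _)
  have hloc : ∀ q : ℕ, q.Prime →
      Summable (fun r : ℕ => a q (r + 1) / (q : ℝ) ^ (r + 1)) ∧
        ∑' r : ℕ, a q (r + 1) / (q : ℝ) ^ (r + 1) ≤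
          ‖powI b q - 1‖ * (g q 1 / q + LogEulerProduct.tailConst d / (q : ℝ) ^ 2) := by
    intro q hq
    obtain ⟨hs, hle⟩ := tsum_shape_div_pow_succ_le (g := g) (d := d) hq (hg0 q) (fun r => hg q r hq)
    have e : (fun r : ℕ => a q (r + 1) / (q : ℝ) ^ (r + 1)) =
        fun r : ℕ => ‖powI b q - 1‖ * (g q (r + 1) / (q : ℝ) ^ (r + 1)) := by
      funext r; simp only [ha_def]; ring
    rw [e]
    refine ⟨hs.mul_left _, ?_⟩
    rw [tsum_mul_left]
    exact mul_le_mul_of_nonneg_left hle (norm_nonneg _)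
  have hsumm : ∀ q : ℕ, q.Prime → Summable (fun r : ℕ => a q (r + 1) / (q : ℝ) ^ (r + 1)) :=
    fun q hq => (hloc q hq).1
  -- rewrite the summand as the majorant `M_a`
  have hrew : ∑ n ∈ A with n ≠ 1, (∏ q ∈ n.primeFactors, g q (n.factorization q)) * ‖kappa₂ b n‖ / n =
      ∑ n ∈ A with n ≠ 1, (∏ q ∈ n.primeFactors, a q (n.factorization q)) / n := by
    refine Finset.sum_congr rfl fun n hn => ?_
    have hn0 : n ≠ 0 := Nat.ne_zero_of_mem_factoredNumbers (hA n (Finset.mem_filter.mp hn).1)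
    rw [multMajorant_mul_norm_kappa₂_eq b g hn0]
  rw [hrew]
  refine (sum_factored_multMajorant_div_sub_one_le ha hsumm hA).trans ?_
  have hP : ∀ q ∈ s.filter Nat.Prime, q.Prime := fun q hq => (Finset.mem_filter.mp hq).2
  have hprod : ∏ q ∈ s with q.Prime, (1 + ∑' r : ℕ, a q (r + 1) / (q : ℝ) ^ (r + 1)) ≤
      ∏ q ∈ s with q.Prime,
        (1 + ‖powI b q - 1‖ * (g q 1 / q + LogEulerProduct.tailConst d / (q : ℝ) ^ 2)) := by
    refine Finset.prod_le_prod (fun q hq => ?_) fun q hq => by linarith [(hloc q (hP q hq)).2]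
    have : 0 ≤ ∑' r : ℕ, a q (r + 1) / (q : ℝ) ^ (r + 1) := tsum_nonneg fun r => by
      exact div_nonneg (ha q _) (by positivity)
    linarith
  have hexp := Literature.NumberTheory.Sieve.prod_one_add_le_exp_sum (s.filter Nat.Prime)
    (f := fun q => ‖powI b q - 1‖ * (g q 1 / q + LogEulerProduct.tailConst d / (q : ℝ) ^ 2))
    (fun q _ => mul_nonneg (norm_nonneg _) (add_nonneg (div_nonneg (hg0 q 1) (Nat.cast_nonneg q))
      (div_nonneg (LogEulerProduct.tailConst_nonneg d) (by positivity))))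
  linarith

/-- **THE `κ₂`-GAIN EULER SUM, linear form**: if moreover `X ≤ 1` then
`Σ_{n∈A, n≠1} M_g(n)|κ₂(n)|/n ≤ 2X`. [cite: Zhang2022LandauSiegel, §17 u021 p.98] -/
theorem sum_multMajorant_mul_norm_kappa₂_div_le_two_mul (b : ℝ) {g : ℕ → ℕ → ℝ} {d : ℕ}
    (hg0 : ∀ q r, 0 ≤ g q r) (hg : ∀ q r, q.Prime → g q r ≤ ((r : ℝ) + 1) ^ d)
    {s A : Finset ℕ} (hA : ∀ n ∈ A, n ∈ Nat.factoredNumbers s)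
    (hX : ∑ q ∈ s with q.Prime,
      ‖powI b q - 1‖ * (g q 1 / q + LogEulerProduct.tailConst d / (q : ℝ) ^ 2) ≤ 1) :
    ∑ n ∈ A with n ≠ 1, (∏ q ∈ n.primeFactors, g q (n.factorization q)) * ‖kappa₂ b n‖ / n ≤
      2 * ∑ q ∈ s with q.Prime,
        ‖powI b q - 1‖ * (g q 1 / q + LogEulerProduct.tailConst d / (q : ℝ) ^ 2) := by
  refine (sum_multMajorant_mul_norm_kappa₂_div_le b hg0 hg hA).trans ?_
  set X := ∑ q ∈ s with q.Prime,
    ‖powI b q - 1‖ * (g q 1 / q + LogEulerProduct.tailConst d / (q : ℝ) ^ 2) with hXdef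
  have h0 : 0 ≤ X := Finset.sum_nonneg fun q _ => mul_nonneg (norm_nonneg _)
    (add_nonneg (div_nonneg (hg0 q 1) (Nat.cast_nonneg q))
      (div_nonneg (LogEulerProduct.tailConst_nonneg d) (by positivity)))
  have h2 := Real.abs_exp_sub_one_le (x := X) (by rwa [abs_of_nonneg h0])
  rw [abs_of_nonneg h0] at h2
  exact (abs_le.mp h2).2

/-- **THE `κ₂`-GAIN EULER SUM over the numbers with at least two prime factors**: for `X ≤ 1`,
`Σ_{n∈A, ω(n)≥2} M_g(n)|κ₂(n)|/n ≤ X²` (two gains; in §17 the terms `m₂ > T²/(4D⁴)` with `ω(m₂) ≥ 2`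
are thereby `≍ 𝓛^{−15.8}` against a crude outer count `𝓛^{12}`). [cite: Zhang2022LandauSiegel, §17 u021 p.98] -/
theorem sum_multMajorant_mul_norm_kappa₂_div_le_sq (b : ℝ) {g : ℕ → ℕ → ℝ} {d : ℕ}
    (hg0 : ∀ q r, 0 ≤ g q r) (hg : ∀ q r, q.Prime → g q r ≤ ((r : ℝ) + 1) ^ d)
    {s A : Finset ℕ} (hA : ∀ n ∈ A, n ∈ Nat.factoredNumbers s)
    (hX : ∑ q ∈ s with q.Prime,
      ‖powI b q - 1‖ * (g q 1 / q + LogEulerProduct.tailConst d / (q : ℝ) ^ 2) ≤ 1) :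
    ∑ n ∈ A with 2 ≤ n.primeFactors.card,
        (∏ q ∈ n.primeFactors, g q (n.factorization q)) * ‖kappa₂ b n‖ / n ≤
      (∑ q ∈ s with q.Prime,
        ‖powI b q - 1‖ * (g q 1 / q + LogEulerProduct.tailConst d / (q : ℝ) ^ 2)) ^ 2 := by
  classical
  set a : ℕ → ℕ → ℝ := fun q r => g q r * ‖powI b q - 1‖ with ha_def
  have ha : ∀ q r, 0 ≤ a q r := fun q r => mul_nonneg (hg0 q r) (norm_nonneg _)
  set x : ℕ → ℝ := fun q =>
    ‖powI b q - 1‖ * (g q 1 / q + LogEulerProduct.tailConst d / (q : ℝ) ^ 2) with hx_def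
  have hx0 : ∀ q, 0 ≤ x q := fun q => mul_nonneg (norm_nonneg _)
    (add_nonneg (div_nonneg (hg0 q 1) (Nat.cast_nonneg q))
      (div_nonneg (LogEulerProduct.tailConst_nonneg d) (by positivity)))
  have hloc : ∀ q : ℕ, q.Prime →
      Summable (fun r : ℕ => a q (r + 1) / (q : ℝ) ^ (r + 1)) ∧
        ∑' r : ℕ, a q (r + 1) / (q : ℝ) ^ (r + 1) ≤ x q := by
    intro q hq
    obtain ⟨hs, hle⟩ := tsum_shape_div_pow_succ_le (g := g) (d := d) hq (hg0 q) (fun r => hg q r hq)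
    have e : (fun r : ℕ => a q (r + 1) / (q : ℝ) ^ (r + 1)) =
        fun r : ℕ => ‖powI b q - 1‖ * (g q (r + 1) / (q : ℝ) ^ (r + 1)) := by
      funext r; simp only [ha_def]; ring
    rw [e]
    refine ⟨hs.mul_left _, ?_⟩
    rw [tsum_mul_left]
    exact mul_le_mul_of_nonneg_left hle (norm_nonneg _)
  have hsumm : ∀ q : ℕ, q.Prime → Summable (fun r : ℕ => a q (r + 1) / (q : ℝ) ^ (r + 1)) :=
    fun q hq => (hloc q hq).1
  have hrew : ∑ n ∈ A with 2 ≤ n.primeFactors.card,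
      (∏ q ∈ n.primeFactors, g q (n.factorization q)) * ‖kappa₂ b n‖ / n =
      ∑ n ∈ A with 2 ≤ n.primeFactors.card, (∏ q ∈ n.primeFactors, a q (n.factorization q)) / n := by
    refine Finset.sum_congr rfl fun n hn => ?_
    have hn0 : n ≠ 0 := Nat.ne_zero_of_mem_factoredNumbers (hA n (Finset.mem_filter.mp hn).1)
    rw [multMajorant_mul_norm_kappa₂_eq b g hn0]
  rw [hrew]
  refine (sum_factored_multMajorant_div_le_of_two_le_card ha hsumm hA).trans ?_
  set P := s.filter Nat.Prime with hPdef
  have hP : ∀ q ∈ P, q.Prime := fun q hq => (Finset.mem_filter.mp hq).2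
  set t : ℕ → ℝ := fun q => ∑' r : ℕ, a q (r + 1) / (q : ℝ) ^ (r + 1) with ht_def
  have ht0 : ∀ q ∈ P, 0 ≤ t q := fun q _ => tsum_nonneg fun r => div_nonneg (ha q _) (by positivity)
  have htx : ∑ q ∈ P, t q ≤ ∑ q ∈ P, x q := Finset.sum_le_sum fun q hq => (hloc q (hP q hq)).2
  have hT1 : ∑ q ∈ P, t q ≤ 1 := htx.trans hX
  have h1 := prod_one_add_sub_one_sub_sum_le P (x := t) ht0 hT1
  have hT0 : 0 ≤ ∑ q ∈ P, t q := Finset.sum_nonneg ht0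
  have hsq : (∑ q ∈ P, t q) ^ 2 ≤ (∑ q ∈ P, x q) ^ 2 := pow_le_pow_left₀ hT0 htx 2
  show ∏ q ∈ P, (1 + t q) - 1 - ∑ q ∈ P, t q ≤ (∑ q ∈ P, x q) ^ 2
  linarith

/-! ## §6 The `m₁`-extraction -/

/-- `τ₂(n) = ∏_{q^r∥n}(r+1)` for `n ≥ 1` (multiplicativity of `τ₂` and `τ₂(q^r) = r+1`).
[cite: HallTenenbaum1988, (0.4)] -/
theorem tau_two_eq_prod_primeFactors {n : ℕ} (hn : n ≠ 0) :
    tau 2 n = ∏ q ∈ n.primeFactors, ((n.factorization q : ℝ) + 1) := by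
  rw [ArithmeticFunction.IsMultiplicative.multiplicative_factorization (tau 2)
    (isMultiplicative_tau 2) hn, Nat.prod_factorization_eq_prod_primeFactors]
  refine Finset.prod_congr rfl fun q hq => ?_
  rw [tau_two_prime_pow (Nat.prime_of_mem_primeFactors hq)]

/-- **THE `m₁`-EXTRACTION.** For `m₂ ≥ 1`, every `N` and every real `b`:
`Σ_{1≤m₁≤N} τ₂(m₁)|κ₂(m₁m₂)|/m₁ ≤ |κ₂(m₂)|·∏_{p∣m₂}(1 + 6/p)·exp(6|b|(log N + log 4))`.
Mechanism: `|κ₂(m₁m₂)| = |κ₂(m₂)|·∏_{q∣m₁, q∤m₂}|q^{−ib}−1|` (the whole gain stays with `m₂`); the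
remaining `m₁`-weight `τ₂(m₁)∏_{q∣m₁,q∤m₂}|q^{−ib}−1|` is a prime-power majorant with local sums
`≤ 1 + 6/q` (`q ∣ m₂`) resp. `≤ 1 + 6|b|log q/q` (`q ∤ m₂`), summed over the `(N+1)`-smooth numbers
(`sum_smooth_multMajorant_div_le_prod`) and closed by Mertens `Σ_{q≤N}log q/q ≤ log N + log 4` (`MertensBound.sum_log_div_prime_le`).
In §17 (`|b₁| ≍ 𝓛⁻⁹`, `N ≍ P/T²`) the exponential is an absolute constant.
[cite: Zhang2022LandauSiegel, §17 u021 p.98] -/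
theorem sum_tau_mul_norm_kappa₂_mul_div_le (b : ℝ) {m₂ : ℕ} (hm₂ : m₂ ≠ 0) (N : ℕ) :
    ∑ m₁ ∈ Finset.Icc 1 N, tau 2 m₁ * ‖kappa₂ b (m₁ * m₂)‖ / m₁ ≤
      ‖kappa₂ b m₂‖ * (∏ p ∈ m₂.primeFactors, (1 + 6 / (p : ℝ))) *
        Real.exp (6 * |b| * (Real.log N + Real.log 4)) := by
  classical
  -- the local weight: `w q = 1` at the primes of `m₂`, `= |q^{-ib} - 1|` elsewhere
  set w : ℕ → ℝ := fun q => if q ∈ m₂.primeFactors then 1 else ‖powI b q - 1‖ with hw_def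
  have hw0 : ∀ q, 0 ≤ w q := fun q => by
    simp only [hw_def]; split_ifs
    · exact zero_le_one
    · exact norm_nonneg _
  set a : ℕ → ℕ → ℝ := fun q r => ((r : ℝ) + 1) * w q with ha_def
  have ha : ∀ q r, 0 ≤ a q r := fun q r => mul_nonneg (by positivity) (hw0 q)
  -- termwise identity
  have hterm : ∀ m₁ ∈ Finset.Icc 1 N, tau 2 m₁ * ‖kappa₂ b (m₁ * m₂)‖ / m₁ =
      ‖kappa₂ b m₂‖ * ((∏ q ∈ m₁.primeFactors, a q (m₁.factorization q)) / m₁) := by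
    intro m₁ hm₁
    have hm₁0 : m₁ ≠ 0 := by have := (Finset.mem_Icc.mp hm₁).1; omega
    rw [mul_comm m₁ m₂, norm_kappa₂_mul_eq b hm₂ hm₁0, tau_two_eq_prod_primeFactors hm₁0]
    have hsd : ∏ q ∈ m₁.primeFactors \ m₂.primeFactors, ‖powI b q - 1‖ =
        ∏ q ∈ m₁.primeFactors, w q := by
      rw [Finset.prod_ite, Finset.prod_const_one, one_mul, Finset.sdiff_eq_filter]
    rw [hsd, ha_def, Finset.prod_mul_distrib]
    ring
  rw [Finset.sum_congr rfl hterm, ← Finset.mul_sum]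
  -- the smooth-number Euler product
  have hA : ∀ n ∈ Finset.Icc 1 N, n ∈ Nat.smoothNumbers (N + 1) := by
    intro n hn
    have h := Finset.mem_Icc.mp hn
    exact Nat.mem_smoothNumbers_of_lt (by omega) (by omega)
  have hloc : ∀ q : ℕ, q.Prime →
      Summable (fun r : ℕ => a q (r + 1) / (q : ℝ) ^ (r + 1)) ∧
        ∑' r : ℕ, a q (r + 1) / (q : ℝ) ^ (r + 1) ≤ 6 * w q / q := by
    intro q hq
    obtain ⟨hs, hle⟩ := tsum_succ_two_div_pow_succ_le hq.two_le
    have e : (fun r : ℕ => a q (r + 1) / (q : ℝ) ^ (r + 1)) =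
        fun r : ℕ => w q * (((r : ℝ) + 2) / (q : ℝ) ^ (r + 1)) := by
      funext r; simp only [ha_def]; push_cast; ring
    rw [e]
    refine ⟨hs.mul_left _, ?_⟩
    rw [tsum_mul_left]
    calc w q * ∑' r : ℕ, ((r : ℝ) + 2) / (q : ℝ) ^ (r + 1) ≤ w q * (6 / q) :=
        mul_le_mul_of_nonneg_left hle (hw0 q)
      _ = 6 * w q / q := by ring
  have hE := sum_smooth_multMajorant_div_le_prod ha (fun q hq => (hloc q hq).1) hA
  -- bound the Euler product
  set P : Finset ℕ := (N + 1).primesBelow with hPdef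
  have hPprime : ∀ q ∈ P, q.Prime := fun q hq => (Nat.mem_primesBelow.mp hq).2
  have hfac : ∀ q ∈ P, 1 + ∑' r : ℕ, a q (r + 1) / (q : ℝ) ^ (r + 1) ≤ 1 + 6 * w q / q :=
    fun q hq => by linarith [(hloc q (hPprime q hq)).2]
  have hfac0 : ∀ q ∈ P, 0 ≤ 1 + ∑' r : ℕ, a q (r + 1) / (q : ℝ) ^ (r + 1) := fun q hq => by
    have : 0 ≤ ∑' r : ℕ, a q (r + 1) / (q : ℝ) ^ (r + 1) :=
      tsum_nonneg fun r => div_nonneg (ha q _) (by positivity)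
    linarith
  have hprod1 : ∏ q ∈ P, (1 + ∑' r : ℕ, a q (r + 1) / (q : ℝ) ^ (r + 1)) ≤
      ∏ q ∈ P, (1 + 6 * w q / q) := Finset.prod_le_prod hfac0 hfac
  -- split the product at the primes of `m₂`
  have hsplit : ∏ q ∈ P, (1 + 6 * w q / q) =
      (∏ q ∈ P with q ∈ m₂.primeFactors, (1 + 6 / (q : ℝ))) *
        ∏ q ∈ P with q ∉ m₂.primeFactors, (1 + 6 * ‖powI b q - 1‖ / q) := by
    rw [← Finset.prod_filter_mul_prod_filter_not P (fun q => q ∈ m₂.primeFactors)]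
    congr 1
    · refine Finset.prod_congr rfl fun q hq => ?_
      have h := (Finset.mem_filter.mp hq).2
      simp only [hw_def, if_pos h, mul_one]
    · refine Finset.prod_congr rfl fun q hq => ?_
      have h := (Finset.mem_filter.mp hq).2
      simp only [hw_def, if_neg h]
  have hpart1 : ∏ q ∈ P with q ∈ m₂.primeFactors, (1 + 6 / (q : ℝ)) ≤
      ∏ p ∈ m₂.primeFactors, (1 + 6 / (p : ℝ)) := by
    refine prod_le_prod_of_subset_real (fun q hq => (Finset.mem_filter.mp hq).2)
      (fun q _ => by positivity) fun q _ _ => ?_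
    have : (0 : ℝ) ≤ 6 / q := by positivity
    linarith
  have hpart2 : ∏ q ∈ P with q ∉ m₂.primeFactors, (1 + 6 * ‖powI b q - 1‖ / q) ≤
      Real.exp (6 * |b| * (Real.log N + Real.log 4)) := by
    have h1 : ∏ q ∈ P with q ∉ m₂.primeFactors, (1 + 6 * ‖powI b q - 1‖ / q) ≤
        ∏ q ∈ P, (1 + 6 * ‖powI b q - 1‖ / q) :=
      prod_le_prod_of_subset_real (Finset.filter_subset _ _)
        (fun q _ => by positivity) fun q _ _ => by
          have : (0 : ℝ) ≤ 6 * ‖powI b q - 1‖ / q := by positivity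
          linarith
    have h2 := Literature.NumberTheory.Sieve.prod_one_add_le_exp_sum P (f := fun q => 6 * ‖powI b q - 1‖ / q)
      (fun q _ => by positivity)
    have h3 : ∑ q ∈ P, 6 * ‖powI b q - 1‖ / q ≤ 6 * |b| * (Real.log N + Real.log 4) := by
      have h4 : ∑ q ∈ P, 6 * ‖powI b q - 1‖ / q ≤ ∑ q ∈ P, 6 * |b| * (Real.log q / q) := by
        refine Finset.sum_le_sum fun q hq => ?_
        have hq := hPprime q hq
        have hq0 : (0 : ℝ) < q := by exact_mod_cast hq.pos
        rw [div_le_iff₀ hq0]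
        have := norm_powI_sub_one_le b hq.pos
        calc 6 * ‖powI b q - 1‖ ≤ 6 * (|b| * Real.log q) := by gcongr
          _ = 6 * |b| * (Real.log q / q) * q := by field_simp
      refine h4.trans ?_
      rw [← Finset.mul_sum]
      refine mul_le_mul_of_nonneg_left ?_ (by positivity)
      have h5 := MertensBound.sum_log_div_prime_le N
      rw [Nat.primesLE] at h5
      exact h5
    exact h1.trans (h2.trans (Real.exp_le_exp.mpr h3))
  have hκ : 0 ≤ ‖kappa₂ b m₂‖ := norm_nonneg _
  calc ‖kappa₂ b m₂‖ * ∑ m₁ ∈ Finset.Icc 1 N, (∏ q ∈ m₁.primeFactors, a q (m₁.factorization q)) / m₁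
      ≤ ‖kappa₂ b m₂‖ * ∏ q ∈ P, (1 + ∑' r : ℕ, a q (r + 1) / (q : ℝ) ^ (r + 1)) :=
        mul_le_mul_of_nonneg_left hE hκ
    _ ≤ ‖kappa₂ b m₂‖ * ∏ q ∈ P, (1 + 6 * w q / q) := mul_le_mul_of_nonneg_left hprod1 hκ
    _ = ‖kappa₂ b m₂‖ * ((∏ q ∈ P with q ∈ m₂.primeFactors, (1 + 6 / (q : ℝ))) *
        ∏ q ∈ P with q ∉ m₂.primeFactors, (1 + 6 * ‖powI b q - 1‖ / q)) := by rw [hsplit]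
    _ ≤ ‖kappa₂ b m₂‖ * ((∏ p ∈ m₂.primeFactors, (1 + 6 / (p : ℝ))) *
        Real.exp (6 * |b| * (Real.log N + Real.log 4))) := by
        refine mul_le_mul_of_nonneg_left ?_ hκ
        exact mul_le_mul hpart1 hpart2 (Finset.prod_nonneg fun q _ => by positivity)
          (Finset.prod_nonneg fun q _ => by positivity)
    _ = _ := by ring

end Literature.NumberTheory.LFunctions.Zhang2022.SmoothEulerMajorant

end
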